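import Summits.HubbardSuperconductivity.HubbardSuperconductivity.Theorems.CooperPairDMottWalkCooperPairDMottPairTrialCeilingProductState
import Summits.HubbardSuperconductivity.HubbardSuperconductivity.Theorems.CooperPairDMottWalkCooperPairDMottPairTrialCeilingDecomposition
import Summits.HubbardSuperconductivity.HubbardSuperconductivity.Theorems.CooperPairDMottWalkCooperPairDMottPairTrialCeilingPlaquetteData
import Literature.MathematicalPhysics.QuantumLattice.HubbardWave0RepulsiveProofs
import Literature.MathematicalPhysics.QuantumLattice.PairFieldMomentum
import Literature.MathematicalPhysics.QuantumLattice.FermionRankOneParity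
import Literature.MathematicalPhysics.QuantumLattice.HubbardSzSectorLadder
import HarnessLib

/-!
# Route `LevyLogBootstrap`, crux `DressHalfFilled` (stmt-HubbardSuperconductivity-8148), stub 2
# `stub_plaquetteDictionary`: the plaquette-band product states on the checkerboard torus

Support file (torus level of the plaquette-boson dictionary, clauses (a)–(b) of `PlaquetteDictionary`;
shared verbatim with crux `DressAnyFilling`, stmt-10291). On the torus `Λ_L = FermionTorus 2 L` of even side
`L`, cut into the `(L/2)²` plaquettes `{2c, 2c+1}²` by the tree's block family `f_c : Λ_2 ↪o Λ_L`,
`X ↦ 2c + X` (`FermionTorus.exists_blockFamily`), attach to every plaquette `c` one of the two plaquette states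
`plaquetteStates U (k c)` (`k c = 1`: `|2h⟩ = plaquettePair U`, one hole pair = one boson; `k c = 0`:
`|0h⟩ = plaquetteVacuum U`, no hole). We construct the **band states** `Ω k` of the intra-plaquette
Hamiltonian `H_in = hamiltonian (fermionTorusGraph 2 L \ ⊤.comap plaq) 1 U` (`dressHalfFilled_bandStates`):

* `Ω k` is a unit vector — the honest Jordan–Wigner "product state": the ordered product of the embedded
  rank-one projections `(f_c)_* |s_c⟩⟨s_c|` applied to a basis vector and normalised (the block-DEPENDENT
  version `exists_blockProduct_vector_family` of the tree's `exists_blockProduct_vector`), a simultaneous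
  eigenvector of every embedded even one-plaquette observable having the local state as eigenvector;
* distinct boson configurations give ORTHOGONAL states (eigenvectors of an embedded plaquette particle
  number for the distinct eigenvalues `2 ≠ 4`);
* `Ω k` lies in the electron sector `(N, S^z) = (Σ_c (4 − 2 k_c), 0)` and `H_in Ω k = (Σ_c E(2 k_c)) Ω k`
  (`E = plaquetteEnergy U`; block sums of embedded `N`, `S^z`, `H_plaq` via `hamiltonian_intra_eq_sum_jwEmbed`).

With `Φ e_σ := Ω (k_σ)`, `k_σ(c) = 1 − σ(c)` (spin up at `R` = hole pair on `R`), these are clauses (a) and (b)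
of `PlaquetteDictionary U`; the exhaustion clause (c) and the pair-field clause (e) are later files.

References: W.-F. Tsai, S. A. Kivelson, PRB 73 (2006) 214510, App. A; H. Yao, W.-F. Tsai, S. A. Kivelson, PRB 76 (2007)
161104(R), eq. (2); O. Bratteli, D. W. Robinson, *Operator Algebras and QSM II* (1997) §5.2.2 (product states on the CAR
algebra). All statements are [folklore]; no definition is introduced.
-/

set_option linter.dupNamespace false

noncomputable section

namespace Summit.HubbardSuperconductivity.HubbardSuperconductivity.Theorems.LevyLogBootstrap

open Matrix Finset Literature.MathematicalPhysics.QuantumLattice Literature.Probability.LatticeModels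
open Summit.HubbardSuperconductivity.HubbardSuperconductivity.Theorems.CooperPairDMottWalk
open scoped ComplexOrder

/-! ### Inserting a block-dependent family of commuting operators into an ordered product -/

section ListProduct

variable {N : Type*} [Fintype N] [DecidableEq N] {J : Type*}

/-- Inhomogeneous insertion: if every `X j`, `j ∈ T`, commutes with the factors `P j'`, `j' ≠ j`, of an
ordered product containing `P j` and `X j (P j) = E j (P j)`, then `(Σ_{j ∈ T} X j) ∏ = (Σ_{j ∈ T} E j) ∏`.
[folklore] -/
theorem sum_mul_list_prod_eq_sum_smul (T : Finset J) (X P : J → Matrix N N ℂ) (E : J → ℂ) (l : List J)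
    (hl : ∀ j ∈ T, j ∈ l) (hcomm : ∀ j ∈ T, ∀ j' ∈ l, j' ≠ j → X j * P j' = P j' * X j)
    (hj : ∀ j ∈ T, X j * P j = E j • P j) :
    (∑ j ∈ T, X j) * (l.map P).prod = (∑ j ∈ T, E j) • (l.map P).prod := by
  rw [Finset.sum_mul, Finset.sum_smul]
  exact Finset.sum_congr rfl fun j hjT =>
    mul_list_prod_eq_smul (X j) P j (E j) (hj j hjT) l (hl j hjT) (hcomm j hjT)

end ListProduct

/-! ### The block product vector of a block-dependent family of unit vectors -/

section Product

variable {Λ Λ' : Type*} [LinearOrder Λ] [Fintype Λ] [LinearOrder Λ'] [Fintype Λ'] {J : Type*} [DecidableEq J]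

/-- **The block product vector of a FAMILY of unit vectors.** For order embeddings `f_j : Λ ↪o Λ'`,
`j ∈ T`, with pairwise disjoint ranges and unit vectors `w j` of the small Fock space there is a non-zero
vector `Ω₀` of the big Fock space which is an eigenvector (i) of every embedded EVEN observable `(f_j)_* O`
of one block with `O (w j) = c (w j)`, eigenvalue `c`, and (ii) of every block sum `Σ_{j ∈ T} (f_j)_* O` of
an even `O` with `O (w j) = c_j (w j)`, eigenvalue `Σ_j c_j`. (`Ω₀ = (∏_j (f_j)_* |w j⟩⟨w j|) e_s` for a
suitable basis vector `e_s`; the product is non-zero because its trace factorises.)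
[cite: BratteliRobinsonII1997, §5.2.2] -/
theorem exists_blockProduct_vector_family (T : Finset J) (f : J → Λ ↪o Λ')
    (hdisj : ∀ j ∈ T, ∀ j' ∈ T, j ≠ j' →
      Disjoint ((Finset.univ : Finset Λ).map (f j).toEmbedding) ((Finset.univ : Finset Λ).map (f j').toEmbedding))
    (w : J → Fock (Orb Λ)) (hw1 : ∀ j ∈ T, star (w j) ⬝ᵥ w j = 1) :
    ∃ Ω₀ : Fock (Orb Λ'), Ω₀ ≠ 0 ∧
      (∀ j ∈ T, ∀ (O : Matrix (Finset (Orb Λ)) (Finset (Orb Λ)) ℂ) (c : ℂ),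
        O ∈ carEvenSubalgebra (Finset.univ : Finset (Orb Λ)) → O *ᵥ w j = c • w j →
          jwEmbed (orbEmb (f j)) O *ᵥ Ω₀ = c • Ω₀) ∧
      ∀ (O : Matrix (Finset (Orb Λ)) (Finset (Orb Λ)) ℂ) (c : J → ℂ),
        O ∈ carEvenSubalgebra (Finset.univ : Finset (Orb Λ)) → (∀ j ∈ T, O *ᵥ w j = c j • w j) →
          (∑ j ∈ T, jwEmbed (orbEmb (f j)) O) *ᵥ Ω₀ = (∑ j ∈ T, c j) • Ω₀ := by
  classical
  set P : J → Matrix (Finset (Orb Λ')) (Finset (Orb Λ')) ℂ :=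
    fun j => jwEmbed (orbEmb (f j)) (vecMulVec (w j) (star (w j))) with hP
  set l := T.toList with hl
  set Lp := (l.map P).prod with hLp
  -- the product is non-zero: its trace factorises
  have htr : Lp.trace ≠ 0 :=
    trace_list_prod_jwEmbed_ne_zero f (fun j => vecMulVec (w j) (star (w j))) l (Finset.nodup_toList T)
      (fun j hj j' hj' hne => hdisj j (Finset.mem_toList.1 hj) j' (Finset.mem_toList.1 hj') hne)
      (fun j hj => by
        rw [trace_vecMulVec, dotProduct_comm, hw1 j (Finset.mem_toList.1 hj)]
        exact one_ne_zero)
  have hLp0 : Lp ≠ 0 := fun h => htr (by rw [h, trace_zero])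
  obtain ⟨s, hs⟩ := exists_mulVec_single_ne_zero hLp0
  -- insertion of an even one-block observable
  have hcomm : ∀ (O : Matrix (Finset (Orb Λ)) (Finset (Orb Λ)) ℂ),
      O ∈ carEvenSubalgebra (Finset.univ : Finset (Orb Λ)) →
        ∀ j ∈ T, ∀ j' ∈ l, j' ≠ j → jwEmbed (orbEmb (f j)) O * P j' = P j' * jwEmbed (orbEmb (f j)) O := by
    intro O hO j hj j' hj' hne
    exact (commute_jwEmbed_jwEmbed (hdisj j hj j' (Finset.mem_toList.1 hj') (Ne.symm hne)) hO
      (vecMulVec (w j') (star (w j')))).eq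
  have hown : ∀ (O : Matrix (Finset (Orb Λ)) (Finset (Orb Λ)) ℂ) (j : J) (c : ℂ), O *ᵥ w j = c • w j →
      jwEmbed (orbEmb (f j)) O * P j = c • P j := by
    intro O j c hOw
    rw [hP]
    dsimp only
    rw [← map_mul, mul_vecMulVec, hOw, smul_vecMulVec, jwEmbed_apply, jwEmbed_apply, JWEmbed.embedFun_smul]
  refine ⟨Lp *ᵥ Pi.single s 1, hs, ?_, ?_⟩
  · intro j hj O c hO hOw
    have key := mul_list_prod_eq_smul (jwEmbed (orbEmb (f j)) O) P j c (hown O j c hOw) l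
      (Finset.mem_toList.2 hj) (hcomm O hO j hj)
    rw [mulVec_mulVec, hLp, key, smul_mulVec]
  · intro O c hO hOw
    have key := sum_mul_list_prod_eq_sum_smul T (fun j => jwEmbed (orbEmb (f j)) O) P c l
      (fun j hj => Finset.mem_toList.2 hj) (hcomm O hO) (fun j hj => hown O j (c j) (hOw j hj))
    rw [mulVec_mulVec, hLp, key, smul_mulVec]

/-- Normalised version of `exists_blockProduct_vector_family`: the block product vector may be taken to
be a unit vector. [cite: BratteliRobinsonII1997, §5.2.2] -/
theorem exists_unit_blockProduct_vector_family (T : Finset J) (f : J → Λ ↪o Λ')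
    (hdisj : ∀ j ∈ T, ∀ j' ∈ T, j ≠ j' →
      Disjoint ((Finset.univ : Finset Λ).map (f j).toEmbedding) ((Finset.univ : Finset Λ).map (f j').toEmbedding))
    (w : J → Fock (Orb Λ)) (hw1 : ∀ j ∈ T, star (w j) ⬝ᵥ w j = 1) :
    ∃ Ω : Fock (Orb Λ'), star Ω ⬝ᵥ Ω = 1 ∧
      (∀ j ∈ T, ∀ (O : Matrix (Finset (Orb Λ)) (Finset (Orb Λ)) ℂ) (c : ℂ),
        O ∈ carEvenSubalgebra (Finset.univ : Finset (Orb Λ)) → O *ᵥ w j = c • w j →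
          jwEmbed (orbEmb (f j)) O *ᵥ Ω = c • Ω) ∧
      ∀ (O : Matrix (Finset (Orb Λ)) (Finset (Orb Λ)) ℂ) (c : J → ℂ),
        O ∈ carEvenSubalgebra (Finset.univ : Finset (Orb Λ)) → (∀ j ∈ T, O *ᵥ w j = c j • w j) →
          (∑ j ∈ T, jwEmbed (orbEmb (f j)) O) *ᵥ Ω = (∑ j ∈ T, c j) • Ω := by
  obtain ⟨Ω₀, h0, h1, h2⟩ := exists_blockProduct_vector_family T f hdisj w hw1
  obtain ⟨a, _, ha1⟩ := exists_smul_unit h0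
  refine ⟨a • Ω₀, ha1, ?_, ?_⟩
  · intro j hj O c hO hOw
    rw [mulVec_smul, h1 j hj O c hO hOw, smul_comm]
  · intro O c hO hOw
    rw [mulVec_smul, h2 O c hO hOw, smul_comm]

end Product

/-! ### Plaquettes of the even torus indexed by the coarse torus `TorusSite 2 M` -/

section Index

variable {M : ℕ} [NeZero M]

/-- The natural coordinates `R ↦ (R₀, R₁) ∈ ℕ²` of a coarse-torus site form an injection. [folklore] -/
theorem torusIdx_injective :
    Function.Injective (fun R : TorusSite 2 M => ((R 0).val, (R 1).val)) := by
  intro R R' h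
  simp only [Prod.mk.injEq] at h
  funext i
  fin_cases i
  · exact ZMod.val_injective M h.1
  · exact ZMod.val_injective M h.2

/-- The coordinates of the coarse torus enumerate the block labels `[0, M)²`. [folklore] -/
theorem map_torusIdx_univ :
    (Finset.univ : Finset (TorusSite 2 M)).map ⟨fun R : TorusSite 2 M => ((R 0).val, (R 1).val), torusIdx_injective⟩ =
      Finset.range M ×ˢ Finset.range M := by
  ext c
  rw [Finset.mem_map, Finset.mem_product, Finset.mem_range, Finset.mem_range]
  constructor
  · rintro ⟨R, -, rfl⟩
    exact ⟨ZMod.val_lt (R 0), ZMod.val_lt (R 1)⟩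
  · rintro ⟨h1, h2⟩
    refine ⟨fun i => ((![c.1, c.2] i : ℕ) : ZMod M), Finset.mem_univ _, ?_⟩
    simp only [Function.Embedding.coeFn_mk, Matrix.cons_val_zero, Matrix.cons_val_one,
      ZMod.val_cast_of_lt h1, ZMod.val_cast_of_lt h2]

/-- Block sums over `[0, M)²` are sums over the coarse torus. [folklore] -/
theorem sum_range_prod_eq_sum_torus {β : Type*} [AddCommMonoid β] (F : ℕ × ℕ → β) :
    ∑ c ∈ Finset.range M ×ˢ Finset.range M, F c = ∑ R : TorusSite 2 M, F ((R 0).val, (R 1).val) := by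
  rw [← map_torusIdx_univ, Finset.sum_map]
  rfl

end Index

/-! ### The band states of the intra-plaquette Hamiltonian -/

section Band

variable {L M : ℕ}

/-- The plaquette states are eigenvectors of the plaquette particle number: `N |k⟩ = (4 − 2k) |k⟩`.
[folklore] -/
theorem totalNumber_mulVec_plaquetteStates (U : ℝ) (k : Fin 2) :
    (totalNumber : Matrix (Finset (Orb PlaquetteSite)) (Finset (Orb PlaquetteSite)) ℂ) *ᵥ plaquetteStates U k =
      (((4 - 2 * (k : ℕ) : ℕ) : ℝ) : ℂ) • plaquetteStates U k := by
  have h := ((mem_szSector_iff _ _ _).1 (plaquetteStates_spec U k).2.1).1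
  rw [(LiebTwo.isNParticle_iff_totalNumber _ _).1 h]
  norm_cast

/-- The plaquette states carry `S^z = 0`. [folklore] -/
theorem spinZ_mulVec_plaquetteStates (U : ℝ) (k : Fin 2) :
    (HubbardWave0.spinZ : Matrix (Finset (Orb PlaquetteSite)) (Finset (Orb PlaquetteSite)) ℂ) *ᵥ plaquetteStates U k =
      ((0 : ℝ) : ℂ) • plaquetteStates U k := by rw [((mem_szSector_iff _ _ _).1 (plaquetteStates_spec U k).2.1).2]

/-- The plaquette states lie in the `(N↑, N↓) = (2 − k, 2 − k)` sectors. [folklore] -/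
theorem isInSector_plaquetteStates (U : ℝ) (k : Fin 2) :
    IsInSector (2 - (k : ℕ)) (2 - (k : ℕ)) (plaquetteStates U k) := by
  have h := (plaquetteStates_spec U k).2.1
  have hk := k.isLt
  have h4 : 4 - 2 * (k : ℕ) = 2 * (2 - (k : ℕ)) := by omega
  rw [h4] at h
  exact (mem_szSector_two_mul_zero_iff _ _).1 h

/-- Distinct plaquette states are orthogonal (different particle numbers). [folklore] -/
theorem star_plaquetteStates_dotProduct {U : ℝ} {i j : Fin 2} (hij : i ≠ j) :
    star (plaquetteStates U i) ⬝ᵥ plaquetteStates U j = 0 := by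
  refine dotProduct_eq_zero_of_isInSector ?_ (isInSector_plaquetteStates U i) (isInSector_plaquetteStates U j)
  have hi := i.isLt; have hj := j.isLt
  have hne : (i : ℕ) ≠ (j : ℕ) := fun h => hij (Fin.ext h)
  omega

/-- The rank-one projections `|k⟩⟨k|` of the plaquette states are even operators. [folklore] -/
theorem vecMulVec_plaquetteStates_mem_carEvenSubalgebra (U : ℝ) (k : Fin 2) :
    vecMulVec (plaquetteStates U k) (star (plaquetteStates U k)) ∈
      carEvenSubalgebra (Finset.univ : Finset (Orb PlaquetteSite)) :=
  vecMulVec_self_mem_carEvenSubalgebra ((mem_szSector_iff _ _ _).1 (plaquetteStates_spec U k).2.1).1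

/-- `|i⟩⟨i| |j⟩ = [i = j] |j⟩` for the plaquette states. [folklore] -/
theorem vecMulVec_plaquetteStates_mulVec (U : ℝ) (i j : Fin 2) :
    vecMulVec (plaquetteStates U i) (star (plaquetteStates U i)) *ᵥ plaquetteStates U j =
      (if i = j then (1 : ℂ) else 0) • plaquetteStates U j := by
  rw [vecMulVec_mulVec, op_smul_eq_smul]
  by_cases hij : i = j
  · subst hij; rw [(plaquetteStates_spec U i).1, if_pos rfl]
  · rw [star_plaquetteStates_dotProduct hij, if_neg hij, zero_smul, zero_smul]

variable [NeZero L] [NeZero M]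

omit [NeZero L] in
/-- Distinct coarse-torus sites label plaquette blocks with disjoint ranges. [folklore] -/
theorem disjoint_range_blockFamily_torus (hLM : L = 2 * M) {f : ℕ × ℕ → (FermionTorus 2 2 ↪o FermionTorus 2 L)}
    (hf : ∀ c ∈ Finset.range (L / 2) ×ˢ Finset.range (L / 2), ∀ X j,
      (ofLex (f c X) j : ℕ) = ![c.1 * 2, c.2 * 2] j + (ofLex X j : ℕ)) :
    ∀ R ∈ (Finset.univ : Finset (TorusSite 2 M)), ∀ R' ∈ (Finset.univ : Finset (TorusSite 2 M)), R ≠ R' →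
      Disjoint ((Finset.univ : Finset PlaquetteSite).map (f ((R 0).val, (R 1).val)).toEmbedding)
        ((Finset.univ : Finset PlaquetteSite).map (f ((R' 0).val, (R' 1).val)).toEmbedding) := by
  have hM : L / 2 = M := by omega
  intro R _ R' _ hne
  have hR : ((R 0).val, (R 1).val) ∈ Finset.range (L / 2) ×ˢ Finset.range (L / 2) := by
    rw [hM, ← map_torusIdx_univ]; exact Finset.mem_map_of_mem _ (Finset.mem_univ R)
  have hR' : ((R' 0).val, (R' 1).val) ∈ Finset.range (L / 2) ×ˢ Finset.range (L / 2) := by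
    rw [hM, ← map_torusIdx_univ]; exact Finset.mem_map_of_mem _ (Finset.mem_univ R')
  have hne' : ((R 0).val, (R 1).val) ≠ ((R' 0).val, (R' 1).val) := fun h => hne (torusIdx_injective h)
  exact disjoint_map_of_ne_range _ f (FermionTorus.blockFamily_ne (M := 2) (by norm_num) hf) (fun _ => Finset.univ)
    _ hR _ hR' hne'

omit [NeZero L] in
/-- The plaquette blocks labelled by the coarse torus cover the torus. [folklore] -/
theorem biUnion_range_blockFamily_torus (hLM : L = 2 * M) {f : ℕ × ℕ → (FermionTorus 2 2 ↪o FermionTorus 2 L)}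
    (hf : ∀ c ∈ Finset.range (L / 2) ×ˢ Finset.range (L / 2), ∀ X j,
      (ofLex (f c X) j : ℕ) = ![c.1 * 2, c.2 * 2] j + (ofLex X j : ℕ)) :
    (Finset.univ : Finset (TorusSite 2 M)).biUnion
        (fun R => (Finset.univ : Finset PlaquetteSite).map (f ((R 0).val, (R 1).val)).toEmbedding) = Finset.univ := by
  have hM : L / 2 = M := by omega
  have hL : Even L := ⟨M, by omega⟩
  refine Finset.eq_univ_of_forall fun x => Finset.mem_biUnion.2 ?_
  have hx := plaqIdx_mem_blocks hL x
  rw [hM, Finset.mem_product, Finset.mem_range, Finset.mem_range] at hx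
  refine ⟨fun i => ((![(ofLex x 0 : ℕ) / 2, (ofLex x 1 : ℕ) / 2] i : ℕ) : ZMod M), Finset.mem_univ _, ?_⟩
  have h := mem_range_blockFamily_plaqIdx hf hL x
  simp only [Matrix.cons_val_zero, Matrix.cons_val_one, ZMod.val_cast_of_lt hx.1, ZMod.val_cast_of_lt hx.2]
  exact h

/-- **The plaquette decomposition of the intra-plaquette Hamiltonian, indexed by the coarse torus**:
`H_in = Σ_{R : TorusSite 2 M} (f_R)_* H_plaq`. [folklore] -/
theorem hamiltonian_intra_eq_sum_jwEmbed_torus (hLM : L = 2 * M) (U : ℝ)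
    {f : ℕ × ℕ → (FermionTorus 2 2 ↪o FermionTorus 2 L)}
    (hf : ∀ c ∈ Finset.range (L / 2) ×ˢ Finset.range (L / 2), ∀ X j,
      (ofLex (f c X) j : ℕ) = ![c.1 * 2, c.2 * 2] j + (ofLex X j : ℕ)) :
    hamiltonian (fermionTorusGraph 2 L \ (⊤ : SimpleGraph (Fin 2 → ℕ)).comap
        (fun (x : FermionTorus 2 L) (i : Fin 2) => (ofLex x i : ℕ) / 2)) 1 U =
      ∑ R : TorusSite 2 M, jwEmbed (orbEmb (f ((R 0).val, (R 1).val))) (plaquetteHamiltonian U) := by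
  have hM : L / 2 = M := by omega
  have hL : Even L := ⟨M, by omega⟩
  rw [hamiltonian_intra_eq_sum_jwEmbed hL U hf, hM]
  exact sum_range_prod_eq_sum_torus (M := M) (fun c => jwEmbed (orbEmb (f c)) (plaquetteHamiltonian U))

/-- **The band states of the intra-plaquette Hamiltonian of the checkerboard torus** (`L = 2M`). Let
`f_c : Λ_2 ↪o Λ_L` (`c ∈ [0, M)²`) be the plaquette block family `X ↦ 2c + X`, and `k : TorusSite 2 M → Fin 2`
an assignment of hole-pair numbers to the plaquettes (plaquette `R` ↦ block `(R₀, R₁)`). There is a unit vector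
`Ω` of the torus Fock space with: (1) every embedded even one-plaquette observable `(f_R)_* O` with
`O |k R⟩ = a |k R⟩` (`|k⟩ = plaquetteStates U k`) has `Ω` as eigenvector, eigenvalue `a`; in particular
(2) `(f_R)_* |i⟩⟨i| Ω = [i = k R] Ω` for the (even) plaquette-state projections; (3) `Ω` has
`N = Σ_R (4 − 2 k R)` electrons and `S^z = 0`; (4) `Ω` is an eigenvector of the intra-plaquette Hamiltonian
`hamiltonian (fermionTorusGraph 2 L \ ⊤.comap plaq) 1 U`, eigenvalue `Σ_R E(2 k R)`. [cite: TsaiKivelson2006, App. A] -/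
theorem exists_bandState (hLM : L = 2 * M) (U : ℝ)
    {f : ℕ × ℕ → (FermionTorus 2 2 ↪o FermionTorus 2 L)}
    (hf : ∀ c ∈ Finset.range (L / 2) ×ˢ Finset.range (L / 2), ∀ X j,
      (ofLex (f c X) j : ℕ) = ![c.1 * 2, c.2 * 2] j + (ofLex X j : ℕ))
    (k : TorusSite 2 M → Fin 2) :
    ∃ Ω : Fock (Orb (FermionTorus 2 L)), star Ω ⬝ᵥ Ω = 1 ∧
      (∀ (R : TorusSite 2 M) (O : Matrix (Finset (Orb PlaquetteSite)) (Finset (Orb PlaquetteSite)) ℂ) (a : ℂ),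
        O ∈ carEvenSubalgebra (Finset.univ : Finset (Orb PlaquetteSite)) →
          O *ᵥ plaquetteStates U (k R) = a • plaquetteStates U (k R) →
            jwEmbed (orbEmb (f ((R 0).val, (R 1).val))) O *ᵥ Ω = a • Ω) ∧
      (∀ (R : TorusSite 2 M) (i : Fin 2),
        jwEmbed (orbEmb (f ((R 0).val, (R 1).val)))
            (vecMulVec (plaquetteStates U i) (star (plaquetteStates U i))) *ᵥ Ω =
          (if i = k R then (1 : ℂ) else 0) • Ω) ∧
      Ω ∈ szSector (Λ := FermionTorus 2 L) (∑ R : TorusSite 2 M, (4 - 2 * (k R : ℕ))) 0 ∧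
      hamiltonian (fermionTorusGraph 2 L \ (⊤ : SimpleGraph (Fin 2 → ℕ)).comap
          (fun (x : FermionTorus 2 L) (i : Fin 2) => (ofLex x i : ℕ) / 2)) 1 U *ᵥ Ω =
        ((∑ R : TorusSite 2 M, plaquetteEnergy U (2 * (k R : ℕ)) : ℝ) : ℂ) • Ω := by
  have hdisj := disjoint_range_blockFamily_torus hLM hf
  have hcover := biUnion_range_blockFamily_torus hLM hf
  obtain ⟨Ω, hΩ1, hloc, hsum⟩ := exists_unit_blockProduct_vector_family (Finset.univ : Finset (TorusSite 2 M))
    (fun R => f ((R 0).val, (R 1).val)) hdisj (fun R => plaquetteStates U (k R))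
    (fun R _ => (plaquetteStates_spec U (k R)).1)
  refine ⟨Ω, hΩ1, fun R O a hO hOw => hloc R (Finset.mem_univ R) O a hO hOw, ?_, ?_, ?_⟩
  · -- the plaquette-state projections
    intro R i
    exact hloc R (Finset.mem_univ R) _ _ (vecMulVec_plaquetteStates_mem_carEvenSubalgebra U i)
      (vecMulVec_plaquetteStates_mulVec U i (k R))
  · -- particle number and spin
    rw [mem_szSector_iff]
    constructor
    · rw [LiebTwo.isNParticle_iff_totalNumber,
        ← sum_jwEmbed_totalNumber_eq_of_cover _ _ hdisj (by convert hcover using 2),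
        hsum totalNumber (fun R => (((4 - 2 * (k R : ℕ) : ℕ) : ℝ) : ℂ)) totalNumber_mem_carEvenSubalgebra
          (fun R _ => totalNumber_mulVec_plaquetteStates U (k R))]
      push_cast
      rfl
    · rw [← sum_jwEmbed_spinZ_eq_of_cover _ _ hdisj (by convert hcover using 2),
        hsum HubbardWave0.spinZ (fun _ => ((0 : ℝ) : ℂ)) spinZ_mem_carEvenSubalgebra
          (fun R _ => spinZ_mulVec_plaquetteStates U (k R))]
      simp
  · -- energy
    have hH : plaquetteHamiltonian U ∈ carEvenSubalgebra (Finset.univ : Finset (Orb PlaquetteSite)) :=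
      hubbardTorus_two_mem_carEvenSubalgebra U
    rw [hamiltonian_intra_eq_sum_jwEmbed_torus hLM U hf,
      hsum (plaquetteHamiltonian U) (fun R => ((plaquetteEnergy U (2 * (k R : ℕ)) : ℝ) : ℂ)) hH
        (fun R _ => plaquetteHamiltonian_mulVec_plaquetteStates U (k R))]
    push_cast
    rfl

omit [NeZero L] [NeZero M] in
/-- **Distinct hole-pair assignments give orthogonal band states**: unit vectors carrying the plaquette-state
projection relations of `exists_bandState` for assignments `k ≠ k'` are orthogonal (at a plaquette `R` with
`k R ≠ k' R` the embedded projection `(f_R)_* |k R⟩⟨k R|` fixes one and kills the other). [folklore] -/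
theorem bandState_orthogonal {f : ℕ × ℕ → (FermionTorus 2 2 ↪o FermionTorus 2 L)} (U : ℝ)
    {k k' : TorusSite 2 M → Fin 2} (hkk' : k ≠ k') {Ω Ω' : Fock (Orb (FermionTorus 2 L))}
    (hΩ : ∀ (R : TorusSite 2 M) (i : Fin 2),
      jwEmbed (orbEmb (f ((R 0).val, (R 1).val))) (vecMulVec (plaquetteStates U i) (star (plaquetteStates U i))) *ᵥ Ω =
        (if i = k R then (1 : ℂ) else 0) • Ω)
    (hΩ' : ∀ (R : TorusSite 2 M) (i : Fin 2),
      jwEmbed (orbEmb (f ((R 0).val, (R 1).val))) (vecMulVec (plaquetteStates U i) (star (plaquetteStates U i))) *ᵥ Ω' =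
        (if i = k' R then (1 : ℂ) else 0) • Ω') :
    star Ω ⬝ᵥ Ω' = 0 := by
  obtain ⟨R, hR⟩ : ∃ R, k R ≠ k' R := by
    by_contra h
    exact hkk' (funext fun R => not_not.1 (not_exists.1 h R))
  set P := jwEmbed (orbEmb (f ((R 0).val, (R 1).val)))
    (vecMulVec (plaquetteStates U (k R)) (star (plaquetteStates U (k R)))) with hP
  have hPh : Pᴴ = P := by
    rw [hP, ← jwEmbed_conjTranspose, conjTranspose_vecMulVec, star_star]
  have h1 : P *ᵥ Ω = Ω := by rw [hP, hΩ R (k R), if_pos rfl, one_smul]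
  have h2 : P *ᵥ Ω' = 0 := by rw [hP, hΩ' R (k R), if_neg hR, zero_smul]
  calc star Ω ⬝ᵥ Ω' = star (P *ᵥ Ω) ⬝ᵥ Ω' := by rw [h1]
    _ = star Ω ⬝ᵥ (Pᴴ *ᵥ Ω') := by rw [star_mulVec, ← dotProduct_mulVec]
    _ = 0 := by rw [hPh, h2, dotProduct_zero]

end Band

/-! ### Registered forms -/

/-- **Registered sub-goal `dressHalfFilled_bandStatesTorus`** (closed form, as registered on the crux item
stmt-HubbardSuperconductivity-8148): for `L = 2M` and every assignment `k : TorusSite 2 M → Fin 2` of hole-pair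
numbers to the plaquettes there is a unit band state — a simultaneous eigenvector of the embedded even
one-plaquette observables diagonal on the local states `|k R⟩`, fixed/killed by the embedded plaquette-state
projections, lying in the electron sector `(Σ_R (4 − 2 k R), 0)`, and an eigenvector of the intra-plaquette
Hamiltonian with eigenvalue `Σ_R E(2 k R)` (clauses (a)–(b) of `PlaquetteDictionary` for the product isometry).
[cite: TsaiKivelson2006, App. A] -/
theorem dressHalfFilled_bandStatesTorus : ∀ {L M : ℕ} [NeZero L] [NeZero M], L = 2 * M → ∀ (U : ℝ) {f : ℕ × ℕ → (FermionTorus 2 2 ↪o FermionTorus 2 L)}, (∀ c ∈ Finset.range (L / 2) ×ˢ Finset.range (L / 2), ∀ X j, (ofLex (f c X) j : ℕ) = ![c.1 * 2, c.2 * 2] j + (ofLex X j : ℕ)) → ∀ (k : TorusSite 2 M → Fin 2), ∃ Ω : Fock (Orb (FermionTorus 2 L)), star Ω ⬝ᵥ Ω = 1 ∧ (∀ (R : TorusSite 2 M) (O : Matrix (Finset (Orb PlaquetteSite)) (Finset (Orb PlaquetteSite)) ℂ) (a : ℂ), O ∈ carEvenSubalgebra (Finset.univ : Finset (Orb PlaquetteSite))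 → O *ᵥ plaquetteStates U (k R) = a • plaquetteStates U (k R) → jwEmbed (orbEmb (f ((R 0).val, (R 1).val))) O *ᵥ Ω = a • Ω) ∧ (∀ (R : TorusSite 2 M) (i : Fin 2), jwEmbed (orbEmb (f ((R 0).val, (R 1).val))) (vecMulVec (plaquetteStates U i) (star (plaquetteStates U i))) *ᵥ Ω = (if i = k R then (1 : ℂ) else 0) • Ω) ∧ Ω ∈ szSector (Λ := FermionTorus 2 L) (∑ R : TorusSite 2 M, (4 - 2 * (k R : ℕ))) 0 ∧ hamiltonian (fermionTorusGraph 2 L \ (⊤ : SimpleGraph (Fin 2 → ℕ)).comap (fun (x : FermionTorus 2 L) (i : Fin 2) => (ofLex x i : ℕ) / 2)) 1 U *ᵥ Ω = ((∑ R : TorusSite 2 M, plaquetteEnergy U (2 * (k R : ℕ)) : ℝ) : ℂ) • Ω :=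
  fun hLM U _ hf k => exists_bandState hLM U hf k

/-- **Registered sub-goal `dressHalfFilled_bandStatesOrthogonal`** (closed form): band states of distinct
hole-pair assignments are orthogonal. [folklore] -/
theorem dressHalfFilled_bandStatesOrthogonal : ∀ {L M : ℕ} {f : ℕ × ℕ → (FermionTorus 2 2 ↪o FermionTorus 2 L)} (U : ℝ) {k k' : TorusSite 2 M → Fin 2}, k ≠ k' → ∀ {Ω Ω' : Fock (Orb (FermionTorus 2 L))}, (∀ (R : TorusSite 2 M) (i : Fin 2), jwEmbed (orbEmb (f ((R 0).val, (R 1).val))) (vecMulVec (plaquetteStates U i) (star (plaquetteStates U i))) *ᵥ Ω = (if i = k R then (1 : ℂ) else 0) • Ω) → (∀ (R : TorusSite 2 M) (i : Fin 2), jwEmbed (orbEmb (f ((R 0).val, (R 1).val))) (vecMulVec (plaquetteStates U i) (star (plaquetteStates U i))) *ᵥ Ω' = (if i = k' R then (1 : ℂ) else 0) • Ω') → star Ω ⬝ᵥ Ω' = 0 :=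
  fun U _ _ hkk' _ _ hΩ hΩ' => bandState_orthogonal U hkk' hΩ hΩ'

end Summit.HubbardSuperconductivity.HubbardSuperconductivity.Theorems.LevyLogBootstrap

end
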